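import Summits.QuantumFields.GaugeBoot.LoopEquationFunctional
import Summits.QuantumFields.GaugeBoot.PeriodicLoopEquation
import Summits.QuantumFields.GaugeBoot.WordSpaces
import HarnessLib

/-!
# Gauge-boot: the single-link loop equation AT THE LEVEL OF FUNCTIONALS on any periodic lattice `(A, e)` —
# `ℤ^d` included (large-`N` supplement 19, part 2)

HONEST FRAMING (cell `pub-gaugeboot`, page 1 of every file): certified bounds on lattice
expectations at STATED coupling, gauge group, dimension and torus size; NOT a mass gap, NOT a
continuum limit, NOT a string tension, NOT large `N`; NOT Yang–Mills-summit-bearing (barriers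
`FixedCouplingUltralocality`, `PerturbativeInvisibility`).  Structural (what an SDP-feasible point or a
putative state satisfies); it certifies no number.

## Content

`LoopEquationFunctional.lean` (supplement 18, part 5a) is typed over the cubic torus.  The same contraction runs
over the periodic word calculus of `PeriodicWords.lean` / `PeriodicLoopEquation.lean`, i.e. for every periodic
lattice `(A, e)` — and hence for the infinite lattice `(ℤ^d, zdUnit)`, where the functional may be the expectation
of a DLR state or a feasible point of the Anderson–Kruczenski / Kazakov–Zheng SDP on `ℤ^d`:

* `TiltedRP.SDPairF r e φ β x μ x₀ w X` — THE PAIR ROW of a linear functional `φ` on `C(Config A d G, ℝ)`: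
  for every `Y`, `Φ(tr(Y·insDeriv_X hol_w)) = β·Φ(tr(Y ρ(hol_w))·(−½ plaqIns_X))`, `Φ = evalC φ`;
* `sdPairF_of_parts / _of_traceless / _of_skew` — polarisation;
* ★★ `loopEquationF_of_sdPairF` — for a word closed at `x` and the rows for all `E_ij − (s/N)δ_ij`:
  `Σ_k Φ(splitTerm_k) + (β/2)·Σ_{ν≠μ,ε} Φ(plaqTerm_{ν,ε}) = 0`;
* generic helpers for functionals on `C(ι → G, ℝ)`: `evalC_sum₂'`, `evalR_sum₂'`, ★ `evalR_norm_sq_nonneg_of_entriesIn`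
  (`0 ≤ φ(‖W‖²_F)` for a matrix observable with level-`n` word entries when `φ` is non-negative on level-`n`
  squares), `evalR_sq_nonneg_of_mem`, `evalR_sq_nonneg_of_mem_wordFunctions`.
[folklore] (Makeenko–Migdal / Kazakov–Zheng loop equations as linear constraints on a putative state.)
-/

noncomputable section

open Filter Topology NormedSpace
open scoped Matrix.Norms.Frobenius Matrix
open Literature.MathematicalPhysics.QuantumFieldTheory

namespace Summit.QuantumFields.GaugeBoot

/-! ## Generic helpers: functionals on `C(ι → G, ℝ)` -/

section Generic

variable {X : Type*} [TopologicalSpace X] (φ : C(X, ℝ) →ₗ[ℝ] ℝ)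

/-- Double finite sums under `Φ`. [folklore] -/
theorem evalC_sum₂' {ι κ : Type*} (s : Finset ι) (t : Finset κ) (F : ι → κ → X → ℂ)
    (hF : ∀ i k, Continuous (F i k)) :
    evalC φ (fun U => ∑ i ∈ s, ∑ k ∈ t, F i k U) = ∑ i ∈ s, ∑ k ∈ t, evalC φ (F i k) := by
  rw [evalC_sum φ s _ fun i => continuous_finsetSum t fun k _ => hF i k]
  exact Finset.sum_congr rfl fun i _ => evalC_sum φ t _ fun k => hF i k

/-- Double finite sums under `evalR`. [folklore] -/
theorem evalR_sum₂' {ι κ : Type*} (s : Finset ι) (t : Finset κ) (f : ι → κ → X → ℝ)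
    (hf : ∀ i k, Continuous (f i k)) :
    evalR φ (fun U => ∑ i ∈ s, ∑ k ∈ t, f i k U) = ∑ i ∈ s, ∑ k ∈ t, evalR φ (f i k) := by
  rw [evalR_sum φ s _ fun i => continuous_finsetSum t fun k _ => hf i k]
  exact Finset.sum_congr rfl fun i _ => evalR_sum φ t _ fun k => hf i k

end Generic

section Words

variable {ι : Type*} {G : Type*} [Group G] [TopologicalSpace G] (r : LatticeRep G) (φ : C(ι → G, ℝ) →ₗ[ℝ] ℝ)

/-- ★ **`0 ≤ φ(‖W‖²_F)` for a matrix observable with level-`n` word entries**, when `φ` is non-negative on the squares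
of level-`n` test functions: `‖W‖² = Σ_{ab} (Re W_ab)² + (Im W_ab)²`. [folklore] -/
theorem evalR_norm_sq_nonneg_of_entriesIn {n : ℕ} (hpos : ∀ v ∈ wordTruncation (ι := ι) r n, 0 ≤ φ (v * v))
    {W : (ι → G) → Matrix (Fin r.N) (Fin r.N) ℂ} (hW : EntriesIn r (Set.univ : Set ι) n W) :
    0 ≤ evalR φ (fun U => ‖W U‖ ^ 2) := by
  have hsq : ∀ a b, ∃ gre gim : C(ι → G, ℝ), gre ∈ wordTruncation (ι := ι) r n ∧
      gim ∈ wordTruncation (ι := ι) r n ∧ (∀ U, gre U = (W U a b).re) ∧ ∀ U, gim U = (W U a b).im := by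
    intro a b
    obtain ⟨gre, hgre, hgre'⟩ := (mem_wordFunctions_iff r).1 (hW a b).1
    obtain ⟨gim, hgim, hgim'⟩ := (mem_wordFunctions_iff r).1 (hW a b).2
    exact ⟨gre, gim, mem_wordTruncation_of_mem_wordSpace r hgre, mem_wordTruncation_of_mem_wordSpace r hgim,
      fun U => congrFun hgre' U, fun U => congrFun hgim' U⟩
  choose gre gim hgre hgim hre him using hsq
  have hentry : ∀ a b, (fun U => ‖W U a b‖ ^ 2) = ⇑(gre a b * gre a b + gim a b * gim a b) := by
    intro a b
    funext U
    simp only [ContinuousMap.add_apply, ContinuousMap.mul_apply, hre, him, Complex.sq_norm, Complex.normSq_apply]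
  have hcont : ∀ a b, Continuous fun U => ‖W U a b‖ ^ 2 := fun a b => by
    rw [hentry a b]; exact ContinuousMap.continuous _
  have hexp : (fun U => ‖W U‖ ^ 2) = fun U => ∑ a, ∑ b, ‖W U a b‖ ^ 2 := by
    funext U; exact UnitaryCayley.frobenius_norm_sq (W U)
  rw [hexp, evalR_sum₂' φ _ _ _ hcont]
  refine Finset.sum_nonneg fun a _ => Finset.sum_nonneg fun b _ => ?_
  rw [hentry a b, evalR_coe, map_add]
  exact add_nonneg (hpos _ (hgre a b)) (hpos _ (hgim a b))

/-- `0 ≤ φ(v²)` for a single level-`n` test function given unbundled. [folklore] -/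
theorem evalR_sq_nonneg_of_mem {n : ℕ} (hpos : ∀ v ∈ wordTruncation (ι := ι) r n, 0 ≤ φ (v * v))
    {v : C(ι → G, ℝ)} (hv : v ∈ wordTruncation (ι := ι) r n) :
    0 ≤ evalR φ (fun U => v U ^ 2) := by
  have h : (fun U => v U ^ 2) = ⇑(v * v) := by funext U; simp [sq]
  rw [h, evalR_coe]
  exact hpos v hv

/-- `0 ≤ φ(f²)` for a word FUNCTION of degree `m ≤ n` (unbundled form). [folklore] -/
theorem evalR_sq_nonneg_of_mem_wordFunctions {n m : ℕ} (hmn : m ≤ n)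
    (hpos : ∀ v ∈ wordTruncation (ι := ι) r n, 0 ≤ φ (v * v))
    {f : (ι → G) → ℝ} (hf : f ∈ wordFunctions r (Set.univ : Set ι) m) :
    0 ≤ evalR φ (fun U => f U ^ 2) := by
  obtain ⟨g, hg, hg'⟩ := (mem_wordFunctions_iff r).1 hf
  have hgV : g ∈ wordTruncation (ι := ι) r n :=
    wordTruncation_mono r hmn (mem_wordTruncation_of_mem_wordSpace r hg)
  have h : (fun U => f U ^ 2) = fun U => g U ^ 2 := by rw [← hg']
  rw [h]
  exact evalR_sq_nonneg_of_mem r φ hpos hgV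

end Words

/-! ## The pair row for a functional on a periodic lattice, and polarisation -/

namespace TiltedRP

section PairRow

variable {A : Type} [AddCommGroup A] [DecidableEq A] {d : ℕ} {G : Type} [Group G] [TopologicalSpace G]
  [IsTopologicalGroup G] (r : LatticeRep G) (e : Fin d → A) (φ : C(Config A d G, ℝ) →ₗ[ℝ] ℝ)

/-- THE PAIR ROW of the functional `φ` on the periodic lattice `(A, e)` for the direction `X` (word `w` from `x₀`,
link `(x, μ)`, coupling `β`): for every `Y`, `Φ(tr(Y·insDeriv_X hol_w)) = β·Φ(tr(Y ρ(hol_w))·(−½ plaqIns_X))`,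
`Φ = evalC φ`. [shape] A parametric definition of a proposition — NOT a fact. [folklore] -/
def SDPairF (β : ℝ) (x : A) (μ : Fin d) (x₀ : A) (w : Word d) (X : Matrix (Fin r.N) (Fin r.N) ℂ) : Prop :=
  ∀ Y : Matrix (Fin r.N) (Fin r.N) ℂ,
    evalC φ (fun U => (Y * insDeriv r.ρ e (x, μ) X U x₀ w).trace) =
      (β : ℂ) * evalC φ (fun U => (Y * r.ρ (wordHolonomy e U x₀ w)).trace * (-(1 / 2) * plaqIns r.ρ e X U x μ))

/-- **Polarisation step**: the pair row for the two skew-Hermitian parts of `X` implies it for `X`. [folklore] -/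
theorem sdPairF_of_parts (β : ℝ) (x : A) (μ : Fin d) (x₀ : A) (w : Word d) (X : Matrix (Fin r.N) (Fin r.N) ℂ)
    (hPA : SDPairF r e φ β x μ x₀ w ((1 / 2 : ℂ) • (X - Xᴴ)))
    (hPB : SDPairF r e φ β x μ x₀ w ((Complex.I / 2) • (X + Xᴴ))) : SDPairF r e φ β x μ x₀ w X := by
  set A₁ : Matrix (Fin r.N) (Fin r.N) ℂ := (1 / 2 : ℂ) • (X - Xᴴ) with hA
  set B₁ : Matrix (Fin r.N) (Fin r.N) ℂ := (Complex.I / 2) • (X + Xᴴ) with hB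
  have hXAB : X = A₁ + (-Complex.I) • B₁ := eq_skewPart_add X
  clear_value A₁ B₁
  intro Y
  have hiA := continuous_trace_mul_insDeriv r e Y A₁ (x, μ) x₀ w
  have hiB := continuous_trace_mul_insDeriv r e Y B₁ (x, μ) x₀ w
  have hjA := continuous_rhsIntegrand r e Y A₁ x μ x₀ w
  have hjB := continuous_rhsIntegrand r e Y B₁ x μ x₀ w
  have hiB' : Continuous fun U : Config A d G => (-Complex.I) * (Y * insDeriv r.ρ e (x, μ) B₁ U x₀ w).trace :=
    continuous_const.mul hiB
  have hjB' : Continuous fun U : Config A d G =>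
      (-Complex.I) * ((Y * r.ρ (wordHolonomy e U x₀ w)).trace * (-(1 / 2) * plaqIns r.ρ e B₁ U x μ)) :=
    continuous_const.mul hjB
  have hl : ∀ U : Config A d G, (Y * insDeriv r.ρ e (x, μ) X U x₀ w).trace =
      (Y * insDeriv r.ρ e (x, μ) A₁ U x₀ w).trace + (-Complex.I) * (Y * insDeriv r.ρ e (x, μ) B₁ U x₀ w).trace := by
    intro U
    rw [hXAB, insDeriv_add, insDeriv_smul, Matrix.mul_add, Matrix.mul_smul, Matrix.trace_add, Matrix.trace_smul,
      smul_eq_mul]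
  have hr : ∀ U : Config A d G,
      (Y * r.ρ (wordHolonomy e U x₀ w)).trace * (-(1 / 2) * plaqIns r.ρ e X U x μ) =
        (Y * r.ρ (wordHolonomy e U x₀ w)).trace * (-(1 / 2) * plaqIns r.ρ e A₁ U x μ) +
          (-Complex.I) * ((Y * r.ρ (wordHolonomy e U x₀ w)).trace * (-(1 / 2) * plaqIns r.ρ e B₁ U x μ)) := by
    intro U
    rw [hXAB, plaqIns_add, plaqIns_smul]
    ring
  rw [evalC_congr φ hl, evalC_congr φ hr, evalC_add φ hiA hiB', evalC_smul φ _ hiB,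
    evalC_add φ hjA hjB', evalC_smul φ _ hjB, hPA Y, hPB Y]
  ring

/-- **Polarisation (`𝔰𝔲`-type)**: rows for all traceless skew-Hermitian directions give rows for all traceless
directions. [folklore] -/
theorem sdPairF_of_traceless (β : ℝ) (x : A) (μ : Fin d) (x₀ : A) (w : Word d)
    (hadm : ∀ X : Matrix (Fin r.N) (Fin r.N) ℂ, Xᴴ = -X → X.trace = 0 → SDPairF r e φ β x μ x₀ w X)
    (X : Matrix (Fin r.N) (Fin r.N) ℂ) (hX : X.trace = 0) : SDPairF r e φ β x μ x₀ w X :=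
  sdPairF_of_parts r e φ β x μ x₀ w X (hadm _ (conjTranspose_skewPart X) (trace_parts_eq_zero hX _).1)
    (hadm _ (conjTranspose_iHermPart X) (trace_parts_eq_zero hX _).2)

/-- **Polarisation (`𝔲`-type)**: rows for all skew-Hermitian directions give rows for all directions. [folklore] -/
theorem sdPairF_of_skew (β : ℝ) (x : A) (μ : Fin d) (x₀ : A) (w : Word d)
    (hadm : ∀ X : Matrix (Fin r.N) (Fin r.N) ℂ, Xᴴ = -X → SDPairF r e φ β x μ x₀ w X)
    (X : Matrix (Fin r.N) (Fin r.N) ℂ) : SDPairF r e φ β x μ x₀ w X :=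
  sdPairF_of_parts r e φ β x μ x₀ w X (hadm _ (conjTranspose_skewPart X)) (hadm _ (conjTranspose_iHermPart X))

/-! ## The contraction: the loop equation for the functional -/

/-- ★★ **THE SINGLE-LINK LOOP EQUATION FOR A FUNCTIONAL ON `(A, e)`.**  If `φ` has the pair rows for every direction
`E_ij − (s/N)δ_ij` (word `w` closed at the source `x` of the link `(x, μ)`), then
`Σ_k Φ(splitTerm_k) + (β/2)·Σ_{ν≠μ} Σ_ε Φ(plaqTerm_{ν,ε}) = 0`, `Φ = evalC φ`. [folklore] -/
theorem loopEquationF_of_sdPairF (β : ℝ) (x : A) (μ : Fin d) (s : ℂ) (w : Word d)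
    (hw : Word.endpoint e x w = x) (hP : ∀ i j : Fin r.N, SDPairF r e φ β x μ x w (unitDir s i j)) :
    (∑ k ∈ Finset.range w.length, evalC φ (fun U => splitTerm r.ρ e s x μ U w k)) +
      (β / 2 : ℂ) * ∑ ν ∈ Finset.univ.erase μ, ∑ ε : Bool,
        evalC φ (fun U => plaqTerm r.ρ e s x μ U w ν ε) = 0 := by
  have hf : ∀ i j : Fin r.N, Continuous
      (fun U : Config A d G => (Matrix.single j i (1 : ℂ) * insDeriv r.ρ e (x, μ) (unitDir s i j) U x w).trace) :=
    fun i j => continuous_trace_mul_insDeriv r e _ _ (x, μ) x w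
  have hg : ∀ i j : Fin r.N, Continuous (fun U : Config A d G =>
      (Matrix.single j i (1 : ℂ) * r.ρ (wordHolonomy e U x w)).trace * (-(1 / 2) * plaqIns r.ρ e (unitDir s i j) U x μ)) :=
    fun i j => continuous_rhsIntegrand r e _ _ x μ x w
  have h1 : evalC φ (fun U => ∑ k ∈ Finset.range w.length, splitTerm r.ρ e s x μ U w k) =
      (β : ℂ) * evalC φ (fun U => -(1 / 2) * ∑ ν ∈ Finset.univ.erase μ, ∑ ε : Bool, plaqTerm r.ρ e s x μ U w ν ε) := by
    calc evalC φ (fun U => ∑ k ∈ Finset.range w.length, splitTerm r.ρ e s x μ U w k)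
        = evalC φ (fun U => ∑ i : Fin r.N, ∑ j : Fin r.N,
            (Matrix.single j i (1 : ℂ) * insDeriv r.ρ e (x, μ) (unitDir s i j) U x w).trace) :=
          evalC_congr φ fun U => (sum_trace_insDeriv_unitDir e s x μ U w).symm
      _ = ∑ i : Fin r.N, ∑ j : Fin r.N,
            evalC φ (fun U => (Matrix.single j i (1 : ℂ) * insDeriv r.ρ e (x, μ) (unitDir s i j) U x w).trace) :=
          evalC_sum₂' φ _ _ _ hf
      _ = ∑ i : Fin r.N, ∑ j : Fin r.N, (β : ℂ) * evalC φ (fun U =>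
            (Matrix.single j i (1 : ℂ) * r.ρ (wordHolonomy e U x w)).trace *
              (-(1 / 2) * plaqIns r.ρ e (unitDir s i j) U x μ)) :=
          Finset.sum_congr rfl fun i _ => Finset.sum_congr rfl fun j _ => hP i j (Matrix.single j i 1)
      _ = (β : ℂ) * ∑ i : Fin r.N, ∑ j : Fin r.N, evalC φ (fun U =>
            (Matrix.single j i (1 : ℂ) * r.ρ (wordHolonomy e U x w)).trace *
              (-(1 / 2) * plaqIns r.ρ e (unitDir s i j) U x μ)) := by
          simp only [Finset.mul_sum]
      _ = (β : ℂ) * evalC φ (fun U => ∑ i : Fin r.N, ∑ j : Fin r.N,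
            (Matrix.single j i (1 : ℂ) * r.ρ (wordHolonomy e U x w)).trace *
              (-(1 / 2) * plaqIns r.ρ e (unitDir s i j) U x μ)) := by
          rw [evalC_sum₂' φ _ _ _ hg]
      _ = (β : ℂ) * evalC φ (fun U => -(1 / 2) * ∑ ν ∈ Finset.univ.erase μ, ∑ ε : Bool,
            plaqTerm r.ρ e s x μ U w ν ε) := by
          congr 1
          exact evalC_congr φ fun U => sum_trace_mul_plaqIns_unitDir e s x μ U w hw
  have h2 : evalC φ (fun U => ∑ k ∈ Finset.range w.length, splitTerm r.ρ e s x μ U w k) =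
      ∑ k ∈ Finset.range w.length, evalC φ (fun U => splitTerm r.ρ e s x μ U w k) :=
    evalC_sum φ _ _ fun k => continuous_splitTerm e r s x μ w k
  have h3 : evalC φ (fun U => -(1 / 2) * ∑ ν ∈ Finset.univ.erase μ, ∑ ε : Bool, plaqTerm r.ρ e s x μ U w ν ε) =
      -(1 / 2) * ∑ ν ∈ Finset.univ.erase μ, ∑ ε : Bool, evalC φ (fun U => plaqTerm r.ρ e s x μ U w ν ε) := by
    rw [evalC_smul φ _ (continuous_finsetSum _ fun ν _ => continuous_finsetSum _ fun ε _ =>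
      continuous_plaqTerm e r s x μ w ν ε), evalC_sum₂' φ _ _ _ fun ν ε => continuous_plaqTerm e r s x μ w ν ε]
  rw [← h2, h1, h3]
  ring

end PairRow

end TiltedRP

end Summit.QuantumFields.GaugeBoot

end
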